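import Literature.Geometry.GeometricMeasureTheory.CurrentsWeakCompactness
import Literature.Geometry.GeometricMeasureTheory.CurrentsNullSupport
import Mathlib.Geometry.Manifold.PartitionOfUnity
import Mathlib.LinearAlgebra.Multilinear.FiniteDimensional
import Mathlib.Topology.MetricSpace.Thickening

/-!
# The mass formula `𝐌([W, θ, ξ]) = ∫_W |θ| d𝓗^m`

For the currents of integration `[W, θ, ξ] = (𝓗^m ⌞ W) ∧ θ ξ` of
`Literature.Geometry.GeometricMeasureTheory.Currents` with admissible data (`IsRectifiableData`,
after Federer 4.1.28 (4)) on an open subset `Ω` of a finite-dimensional inner product space, the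
mass is the total variation of the multiplicity:

* `IsRectifiableData.mass_eq` — **`𝐌([W, θ, ξ]) = ∫_W |θ| d𝓗^m`** (Federer 4.1.28 (5):
  "`‖T‖ = 𝓗^m ⌞ Θ^m(‖T‖, ·)`" with `Θ^m(‖T‖, x) = |θ(x)|`, as far as total mass is concerned);
  `IsRectifiableData.mass_lt_top_iff`; `IsRectifiableData.mass_lt_top_of_isCompact_support` —
  rectifiable currents have finite mass (the density vanishes a.e. off the compact support).
* `setLIntegral_enorm_le_mass_vectorCurrent` — `∫_K ‖F‖ dμ ≤ 𝐌(μ ∧ F)` for compact `K ⊆ Ω` and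
  `F` locally `μ`-integrable on `Ω` (the upper bound `𝐌 ≤ ∫ |θ|` is `IsRectifiableData.mass_le`
  of `CurrentsProofs.lean`, using `‖ξ₁ ∧ ⋯ ∧ ξₘ‖ = 1` for orthonormal frames).

The proof of the lower bound avoids measurable selections: a norming SEQUENCE of unit covectors
`D k` (`exists_norming_seq`, separability of `∧^m V`) partitions the carrier into measurable
pieces `B k` on which `⟨D k, F⟩ > (1 - ε) ‖F‖`; finitely many pieces are approximated from inside
by compacts `C k` and from outside by opens (regularity of the finite measure `‖F‖ μ ⌞ K'`), and a
smooth partition of unity subordinate to `{(⋃ C k)ᶜ} ∪ {U k}` glues the constant covectors into a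
test form of comass `≤ 1` (`exists_testForm_bumpSum`, `exists_testForm_integral_ge`) with
`T(φ) ≥ (1 - ε) ∫_K ‖F‖ dμ - 3ε`; then `ε → 0` and `K ↑ Ω` along a compact exhaustion.

Source: H. Federer, *Geometric Measure Theory*, Springer 1969 (`Federer1969`), 4.1.5, 4.1.7,
4.1.28 (held copy `lit book:federernd-geometric-measure-theory`, PDF pp. 296–301, 325–326).
-/

open scoped Distributions ENNReal NNReal Topology
open MeasureTheory TopologicalSpace Set Filter

namespace Literature.Geometry.GeometricMeasureTheory

-- Depth 3: `Integrable`-algebra on `Multivector`-valued maps (see `RectifiableAdd.lean`).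
set_option maxSynthPendingDepth 3

/-! ### A norming sequence of unit covectors -/

section Norming

variable {V : Type*} [NormedAddCommGroup V] [InnerProductSpace ℝ V] [FiniteDimensional ℝ V] {m : ℕ}

/-- Separability of the fibre of `m`-covectors over a finite-dimensional space (it is
finite-dimensional). [folklore] -/
theorem separableSpace_covector : SeparableSpace (Covector V m) := by
  let L : (Covector V m) →ₗ[ℝ] MultilinearMap ℝ (fun _ : Fin m => V) ℝ :=
    { toFun := fun f => f.toContinuousMultilinearMap.toMultilinearMap
      map_add' := fun _ _ => rfl
      map_smul' := fun _ _ => rfl }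
  have hL : Function.Injective L := fun f g h =>
    ContinuousAlternatingMap.ext fun v => (DFunLike.congr_fun h v : _)
  haveI : FiniteDimensional ℝ (Covector V m) := Module.Finite.of_injective L hL
  haveI : ProperSpace (Covector V m) := FiniteDimensional.proper ℝ _
  infer_instance

/-- **A norming sequence of unit covectors**: there are covectors `D k`, `‖D k‖ ≤ 1`, such that
every non-zero `m`-vector `η` is almost normed by one of them: `(1 - δ) ‖η‖ < ⟨D k, η⟩`
(separability of the unit ball of `∧^m V` and `‖η‖ = sup {⟨φ, η⟩ : ‖φ‖ ≤ 1}`).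
[cite: Federer1969, 1.8.1] -/
theorem exists_norming_seq :
    ∃ D : ℕ → Covector V m, (∀ k, ‖D k‖ ≤ 1) ∧
      ∀ (η : Multivector V m) (δ : ℝ), 0 < δ → η ≠ 0 → ∃ k, (1 - δ) * ‖η‖ < η (D k) := by
  haveI := separableSpace_covector (V := V) (m := m)
  obtain ⟨S, hSc, hSd⟩ := TopologicalSpace.exists_countable_dense (Covector V m)
  -- normalise the dense set into the unit ball and enumerate it (together with `0`)
  let nrm : Covector V m → Covector V m := fun s => if ‖s‖ ≤ 1 then s else (0 : Covector V m)
  have hne : (insert (0 : Covector V m) (nrm '' S)).Nonempty := ⟨0, mem_insert _ _⟩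
  obtain ⟨D, hD⟩ := ((hSc.image nrm).insert 0).exists_eq_range hne
  refine ⟨D, fun k => ?_, fun η δ hδ hη => ?_⟩
  · have hk : D k ∈ insert (0 : Covector V m) (nrm '' S) := hD ▸ mem_range_self k
    rcases hk with hk | ⟨s, -, hs⟩
    · rw [hk, norm_zero]; exact zero_le_one
    · rw [← hs]
      by_cases h : ‖s‖ ≤ 1
      · simp only [nrm, if_pos h]; exact h
      · simp only [nrm, if_neg h, norm_zero]; exact zero_le_one
  · -- an almost norming covector of norm `< 1`
    have hη' : 0 < ‖η‖ := norm_pos_iff.2 hη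
    have h1 : (1 - δ / 2) * ‖η‖ < ‖η‖ := by nlinarith
    obtain ⟨φ, hφ1, hφ2⟩ := η.exists_lt_apply_of_lt_opNorm h1
    -- make the value positive
    obtain ⟨φ', hφ'1, hφ'2⟩ : ∃ φ' : Covector V m, ‖φ'‖ < 1 ∧ (1 - δ / 2) * ‖η‖ < η φ' := by
      rcases le_or_gt 0 (η φ) with h | h
      · exact ⟨φ, hφ1, by rwa [Real.norm_eq_abs, abs_of_nonneg h] at hφ2⟩
      · refine ⟨-φ, by rwa [norm_neg], ?_⟩
        rw [map_neg]
        rwa [Real.norm_eq_abs, abs_of_neg h] at hφ2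
    -- approximate `φ'` inside the open unit ball by an element of `S`
    have hopen : IsOpen ({ψ : Covector V m | ‖ψ‖ < 1} ∩ {ψ | (1 - δ) * ‖η‖ < η ψ}) :=
      (isOpen_lt continuous_norm continuous_const).inter
        (isOpen_lt continuous_const η.continuous)
    have hmem : φ' ∈ {ψ : Covector V m | ‖ψ‖ < 1} ∩ {ψ | (1 - δ) * ‖η‖ < η ψ} :=
      ⟨hφ'1, lt_trans (by nlinarith) hφ'2⟩
    obtain ⟨s, ⟨hs1, hs2⟩, hsS⟩ := hSd.inter_open_nonempty _ hopen ⟨φ', hmem⟩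
    have hsD : nrm s ∈ range D := by
      rw [← hD]
      exact mem_insert_of_mem _ (mem_image_of_mem _ hsS)
    obtain ⟨k, hk⟩ := hsD
    refine ⟨k, ?_⟩
    rw [hk]
    have hs1' : ‖s‖ ≤ 1 := le_of_lt hs1
    simp only [nrm, if_pos hs1']
    exact hs2

end Norming

/-! ### Test forms from smooth cutoffs with disjoint supports -/

section BumpSum

variable {V : Type*} [NormedAddCommGroup V] [InnerProductSpace ℝ V] {Ω : Opens V} {m : ℕ}

/-- A smooth compactly supported real function times a constant covector, as a test form.
[folklore] -/
theorem exists_testForm_smul_const (g : V → ℝ) (hg : ContDiff ℝ (⊤ : ℕ∞) g)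
    (hgc : HasCompactSupport g) (hgΩ : tsupport g ⊆ (Ω : Set V)) (D : Covector V m) :
    ∃ φ : TestForm Ω m, ∀ x, φ x = g x • D := by
  refine ⟨⟨fun x => g x • D, hg.smul contDiff_const, hgc.smul_right, ?_⟩, fun x => rfl⟩
  exact (tsupport_smul_subset_left g fun _ => D).trans hgΩ

/-- **Bump sums.** Given finitely many smooth cutoffs `g k : V → [0, 1]` with compact supports in
`Ω` and `Σ g k ≤ 1`, and covectors `D k` with `‖D k‖ ≤ 1`, the test form `φ = Σ g k • D k` has
comass `≤ 1`. [folklore] -/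
theorem exists_testForm_bumpSum {N : ℕ} (g : Fin N → V → ℝ) (hg : ∀ k, ContDiff ℝ (⊤ : ℕ∞) (g k))
    (hgc : ∀ k, HasCompactSupport (g k)) (hgΩ : ∀ k, tsupport (g k) ⊆ (Ω : Set V))
    (hg0 : ∀ k x, 0 ≤ g k x) (hg1 : ∀ x, ∑ k, g k x ≤ 1)
    (D : Fin N → Covector V m) (hD : ∀ k, ‖D k‖ ≤ 1) :
    ∃ φ : TestForm Ω m, (∀ x, ‖φ x‖ ≤ 1) ∧ ∀ x, φ x = ∑ k, g k x • D k := by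
  choose φ hφ using fun k => exists_testForm_smul_const (Ω := Ω) (g k) (hg k) (hgc k) (hgΩ k) (D k)
  refine ⟨∑ k, φ k, fun x => ?_, fun x => by
    rw [sum_apply]; exact Finset.sum_congr rfl fun k _ => hφ k x⟩
  rw [sum_apply]
  simp_rw [hφ]
  calc ‖∑ k, g k x • D k‖ ≤ ∑ k, ‖g k x • D k‖ := norm_sum_le _ _
    _ ≤ ∑ k, g k x := Finset.sum_le_sum fun k _ => by
        rw [norm_smul, Real.norm_eq_abs, abs_of_nonneg (hg0 k x)]
        exact mul_le_of_le_one_right (hg0 k x) (hD k)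
    _ ≤ 1 := hg1 x

end BumpSum


/-! ### The lower bound for the mass of `μ ∧ F` -/

section MassLower

variable {V : Type*} [NormedAddCommGroup V] [InnerProductSpace ℝ V] [FiniteDimensional ℝ V]
  [MeasurableSpace V] [BorelSpace V] {Ω : Opens V} {m : ℕ}

open scoped Manifold ContDiff in
/-- **Core estimate.** For a strongly measurable, integrable `m`-vectorfield `G` with respect to a
measure `μ'`, a compact `K` with an open neighbourhood `U₀` contained in a compact
`K' ⊆ Ω`, and `0 < ε < 1`, there is a test form `φ` of comass `≤ 1`, vanishing off `U₀`, with
`∫ ⟨φ, G⟩ dμ' ≥ (1 - ε) ∫_K ‖G‖ dμ' - 3ε`: partition `K` by the sets on which a member `D k` of a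
norming sequence almost norms `G`, approximate finitely many pieces from inside by compacts and
from outside by opens, and glue the constant covectors `D k` by a smooth partition of unity.
[cite: Federer1969, 4.1.5] -/
theorem exists_testForm_integral_ge (μ' : Measure V) {G : V → Multivector V m}
    (hG : StronglyMeasurable G) (hGi : Integrable G μ') {K K' U₀ : Set V} (hK : IsCompact K)
    (hK' : IsCompact K') (hU₀ : IsOpen U₀) (hKU₀ : K ⊆ U₀) (hU₀K' : U₀ ⊆ K')
    (hK'Ω : K' ⊆ (Ω : Set V)) {ε : ℝ} (hε : 0 < ε) (hε1 : ε < 1) :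
    ∃ φ : TestForm Ω m, (∀ x, ‖φ x‖ ≤ 1) ∧ (∀ x, x ∉ U₀ → φ x = 0) ∧
      (1 - ε) * (∫⁻ x in K, ‖G x‖ₑ ∂μ').toReal - 3 * ε ≤ ∫ x, G x (φ x) ∂μ' := by
  classical
  have hKm : MeasurableSet K := hK.isClosed.measurableSet
  -- the weighted measure `ν = ‖G‖ μ'`
  set ν : Measure V := μ'.withDensity fun x => ‖G x‖ₑ with hν
  have hνapp : ∀ S : Set V, MeasurableSet S → ν S = ∫⁻ x in S, ‖G x‖ₑ ∂μ' := fun S hS =>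
    withDensity_apply _ hS
  have hνtop : ν univ < ⊤ := by
    rw [hνapp _ MeasurableSet.univ, Measure.restrict_univ]
    exact hGi.2
  haveI : IsFiniteMeasure ν := ⟨hνtop⟩
  have hνreal : ∀ S : Set V, MeasurableSet S → (ν S).toReal = ∫ x in S, ‖G x‖ ∂μ' := by
    intro S hS
    rw [hνapp S hS, integral_norm_eq_lintegral_enorm hGi.1.restrict]
  -- Step 1: norming sequence and the measurable partition
  obtain ⟨D, hD1, hDn⟩ := exists_norming_seq (V := V) (m := m)
  let A : ℕ → Set V := fun k => {x | (1 - ε) * ‖G x‖ < G x (D k)}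
  have hGD : ∀ k, Measurable fun x => G x (D k) := fun k =>
    ((ContinuousLinearMap.apply ℝ ℝ (D k)).continuous.comp_stronglyMeasurable hG).measurable
  have hAm : ∀ k, MeasurableSet (A k) := fun k =>
    measurableSet_lt (hG.norm.measurable.const_mul _) (hGD k)
  let B : ℕ → Set V := disjointed A
  have hBm : ∀ k, MeasurableSet (B k) := MeasurableSet.disjointed hAm
  have hBd : Pairwise (Function.onFun Disjoint B) := disjoint_disjointed A
  have hBA : ∀ k, B k ⊆ A k := fun k => disjointed_subset A k
  have hcover : ∀ x, G x ≠ 0 → x ∈ ⋃ k, B k := by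
    intro x hx
    rw [iUnion_disjointed]
    obtain ⟨k, hk⟩ := hDn (G x) ε hε hx
    exact mem_iUnion.2 ⟨k, hk⟩
  -- Step 2: `ν K ≤ Σ_{k<N} ν (K ∩ B k) + ε`
  have hνK : ν K = ∑' k, ν (K ∩ B k) := by
    have h1 : ν K = ν (K ∩ ⋃ k, B k) + ν (K \ ⋃ k, B k) :=
      (measure_inter_add_sdiff _ (MeasurableSet.iUnion hBm)).symm
    have h2 : ν (K \ ⋃ k, B k) = 0 := by
      rw [hνapp _ (hKm.diff (MeasurableSet.iUnion hBm))]
      refine le_antisymm ?_ bot_le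
      calc ∫⁻ x in K \ ⋃ k, B k, ‖G x‖ₑ ∂μ'
          = ∫⁻ x in K \ ⋃ k, B k, (0 : ℝ≥0∞) ∂μ' :=
            setLIntegral_congr_fun (hKm.diff (MeasurableSet.iUnion hBm)) fun x hx => by
              have : G x = 0 := by
                by_contra h
                exact hx.2 (hcover x h)
              rw [this, enorm_zero]
        _ ≤ 0 := by rw [lintegral_zero]
    rw [h1, h2, add_zero, inter_iUnion]
    exact measure_iUnion (fun i j hij => (hBd hij).mono inter_subset_right inter_subset_right)
      fun k => hKm.inter (hBm k)
  obtain ⟨N, hN⟩ : ∃ N : ℕ, ν K ≤ ∑ k ∈ Finset.range N, ν (K ∩ B k) + ENNReal.ofReal ε := by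
    by_cases h0 : ν K = 0
    · exact ⟨0, by rw [h0]; exact bot_le⟩
    · have hlt : ν K - ENNReal.ofReal ε < ⨆ n, ∑ k ∈ Finset.range n, ν (K ∩ B k) := by
        rw [← ENNReal.tsum_eq_iSup_nat, ← hνK]
        exact ENNReal.sub_lt_self (measure_ne_top _ _) h0 (ENNReal.ofReal_pos.2 hε).ne'
      obtain ⟨n, hn⟩ := lt_iSup_iff.1 hlt
      exact ⟨n, tsub_le_iff_right.1 hn.le⟩
  -- Step 3: compacts inside, opens outside
  have hεN0 : 0 < ε / (N + 1) := by positivity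
  have hεN : ENNReal.ofReal (ε / (N + 1)) ≠ 0 := (ENNReal.ofReal_pos.2 hεN0).ne'
  have hC : ∀ i : Fin N, ∃ C : Set V, C ⊆ K ∩ B i ∧ IsCompact C ∧
      ν (K ∩ B i) < ν C + ENNReal.ofReal (ε / (N + 1)) := fun i =>
    (hKm.inter (hBm i)).exists_isCompact_lt_add (measure_ne_top _ _) hεN
  choose C hCsub hCc hCν using hC
  have hCm : ∀ i, MeasurableSet (C i) := fun i => (hCc i).isClosed.measurableSet
  have hO : ∀ i : Fin N, ∃ O : Set V, C i ⊆ O ∧ IsOpen O ∧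
      ν O < ν (C i) + ENNReal.ofReal (ε / (N + 1)) := fun i =>
    (hCc i).exists_isOpen_lt_add hεN
  choose O hCO hOo hOν using hO
  have hOm : ∀ i, MeasurableSet (O i) := fun i => (hOo i).measurableSet
  have hCdisj : ∀ i j, i ≠ j → Disjoint (C i) (C j) := fun i j hij =>
    (hBd (Fin.val_injective.ne hij)).mono ((hCsub i).trans inter_subset_right)
      ((hCsub j).trans inter_subset_right)
  -- Step 4: separating open sets
  let U : Fin N → Set V := fun i =>
    O i ∩ U₀ ∩ (⋃ j ∈ (Finset.univ.filter fun j => j ≠ i), C j)ᶜ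
  have hUo : ∀ i, IsOpen (U i) := fun i => ((hOo i).inter hU₀).inter
    (Finset.isCompact_biUnion _ fun j _ => hCc j).isClosed.isOpen_compl
  have hCU : ∀ i, C i ⊆ U i := by
    intro i x hx
    refine ⟨⟨hCO i hx, hKU₀ (hCsub i hx).1⟩, fun h => ?_⟩
    obtain ⟨j, hj, hxj⟩ := mem_iUnion₂.1 h
    exact Set.disjoint_left.1 (hCdisj i j (Ne.symm (Finset.mem_filter.1 hj).2)) hx hxj
  have hUO : ∀ i, U i ⊆ O i := fun i x hx => hx.1.1
  have hUU₀ : ∀ i, U i ⊆ U₀ := fun i x hx => hx.1.2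
  have hUK' : ∀ i, U i ⊆ K' := fun i => (hUU₀ i).trans hU₀K'
  -- Step 5: smooth partition of unity subordinate to `{(⋃ C)ᶜ} ∪ {U i}`
  let Uo : Option (Fin N) → Set V := fun o => o.elim (⋃ i, C i)ᶜ U
  have hUoo : ∀ o, IsOpen (Uo o) := by
    rintro (_ | i)
    · exact (isCompact_iUnion fun i => hCc i).isClosed.isOpen_compl
    · exact hUo i
  have hUcov : (univ : Set V) ⊆ ⋃ o, Uo o := by
    intro x _
    by_cases hx : x ∈ ⋃ i, C i
    · obtain ⟨i, hi⟩ := mem_iUnion.1 hx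
      exact mem_iUnion.2 ⟨some i, hCU i hi⟩
    · exact mem_iUnion.2 ⟨none, hx⟩
  obtain ⟨f, hf⟩ :=
    SmoothPartitionOfUnity.exists_isSubordinate 𝓘(ℝ, V) isClosed_univ Uo hUoo hUcov
  let g : Fin N → V → ℝ := fun i x => f (some i) x
  have hg_smooth : ∀ i, ContDiff ℝ (⊤ : ℕ∞) (g i) := fun i =>
    contMDiff_iff_contDiff.1 (f (some i)).contMDiff
  have hg_tsupp : ∀ i, tsupport (g i) ⊆ U i := fun i => hf (some i)
  have hg_cpt : ∀ i, HasCompactSupport (g i) := fun i =>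
    IsCompact.of_isClosed_subset hK' (isClosed_tsupport _) ((hg_tsupp i).trans (hUK' i))
  have hg_Ω : ∀ i, tsupport (g i) ⊆ (Ω : Set V) := fun i =>
    ((hg_tsupp i).trans (hUK' i)).trans hK'Ω
  have hg0 : ∀ i x, 0 ≤ g i x := fun i x => f.nonneg (some i) x
  have hg_sum : ∀ x, ∑ i, g i x ≤ 1 := fun x => by
    have h1 := f.sum_le_one x
    rw [finsum_eq_sum_of_fintype, Fintype.sum_option] at h1
    have h0 : 0 ≤ f none x := f.nonneg none x
    change ∑ i, f (some i) x ≤ 1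
    linarith
  have hg_le1 : ∀ i x, g i x ≤ 1 := fun i x =>
    (Finset.single_le_sum (fun j _ => hg0 j x) (Finset.mem_univ i)).trans (hg_sum x)
  have hg_one : ∀ i, ∀ x ∈ C i, g i x = 1 := by
    intro i x hx
    have h1 := f.sum_eq_one (mem_univ x)
    rw [finsum_eq_sum_of_fintype, Fintype.sum_option] at h1
    have hnone : f none x = 0 :=
      image_eq_zero_of_notMem_tsupport fun h => (hf none h) (mem_iUnion.2 ⟨i, hx⟩)
    have hothers : ∀ j, j ≠ i → f (some j) x = 0 := fun j hji =>
      image_eq_zero_of_notMem_tsupport fun h => (hf (some j) h).2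
        (mem_iUnion₂.2 ⟨i, Finset.mem_filter.2 ⟨Finset.mem_univ _, hji.symm⟩, hx⟩)
    rw [hnone, zero_add, Finset.sum_eq_single i (fun j _ hji => hothers j hji)
      (fun h => (h (Finset.mem_univ i)).elim)] at h1
    exact h1
  have hg_zero : ∀ i x, x ∉ U i → g i x = 0 := fun i x hx =>
    image_eq_zero_of_notMem_tsupport fun h => hx (hg_tsupp i h)
  -- Step 6: the test form
  obtain ⟨φ, hφ1, hφ⟩ := exists_testForm_bumpSum (Ω := Ω) g hg_smooth hg_cpt hg_Ω hg0 hg_sum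
    (fun i => D i) (fun i => hD1 i)
  refine ⟨φ, hφ1, fun x hx => ?_, ?_⟩
  · rw [hφ]
    exact Finset.sum_eq_zero fun i _ => by rw [hg_zero i x fun h => hx (hUU₀ i h), zero_smul]
  -- Step 7: the estimate
  have hint : ∀ i, Integrable (fun x => g i x * G x (D i)) μ' := fun i =>
    (hGi.norm).mono' (((hg_smooth i).continuous.aestronglyMeasurable).mul
      (hGD i).aestronglyMeasurable) (Eventually.of_forall fun x => by
        rw [Real.norm_eq_abs, abs_mul, abs_of_nonneg (hg0 i x)]
        calc g i x * |G x (D i)| ≤ 1 * ‖G x‖ :=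
              mul_le_mul (hg_le1 i x) (by
                have := (G x).le_opNorm (D i)
                rw [Real.norm_eq_abs] at this
                exact this.trans (mul_le_of_le_one_right (norm_nonneg _) (hD1 i)))
                (abs_nonneg _) zero_le_one
          _ = ‖G x‖ := one_mul _)
  have hpt : ∀ x, G x (φ x) = ∑ i, g i x * G x (D i) := fun x => by
    rw [hφ x, map_sum]
    simp only [map_smul, smul_eq_mul]
  have hI : ∫ x, G x (φ x) ∂μ' = ∑ i, ∫ x, g i x * G x (D i) ∂μ' := by
    simp_rw [hpt]
    exact integral_finsetSum _ fun i _ => hint i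
  have hpiece : ∀ i, (1 - ε) * (ν (C i)).toReal - ε / (N + 1) ≤ ∫ x, g i x * G x (D i) ∂μ' := by
    intro i
    rw [← integral_add_compl (hCm i) (hint i)]
    -- (a) on `C i`, where `g i = 1` and `D i` almost norms `G`
    have ha : (1 - ε) * (ν (C i)).toReal ≤ ∫ x in C i, g i x * G x (D i) ∂μ' := by
      rw [hνreal _ (hCm i), ← integral_const_mul]
      refine setIntegral_mono_on ((hGi.norm.const_mul _).integrableOn) (hint i).integrableOn (hCm i)
        fun x hx => ?_
      rw [hg_one i x hx, one_mul]
      exact le_of_lt (hBA i (hCsub i hx).2)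
    -- (b) on the complement, where `|g i · G(D i)| ≤ 𝟙_{O i ∖ C i} ‖G‖`
    have hb : -(ε / (N + 1)) ≤ ∫ x in (C i)ᶜ, g i x * G x (D i) ∂μ' := by
      have h1 := abs_integral_le_integral_abs (f := fun x => g i x * G x (D i))
        (μ := μ'.restrict (C i)ᶜ)
      have hind : Integrable ((O i \ C i).indicator fun x => ‖G x‖) μ' :=
        hGi.norm.indicator ((hOm i).diff (hCm i))
      have h2 : ∫ x in (C i)ᶜ, |g i x * G x (D i)| ∂μ' ≤
          ∫ x in (C i)ᶜ, (O i \ C i).indicator (fun x => ‖G x‖) x ∂μ' := by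
        refine setIntegral_mono_on (hint i).abs.integrableOn hind.integrableOn (hCm i).compl
          fun x hx => ?_
        by_cases hxO : x ∈ O i
        · rw [indicator_of_mem (show x ∈ O i \ C i from ⟨hxO, hx⟩), abs_mul, abs_of_nonneg (hg0 i x)]
          calc g i x * |G x (D i)| ≤ 1 * ‖G x‖ :=
                mul_le_mul (hg_le1 i x) (by
                  have := (G x).le_opNorm (D i)
                  rw [Real.norm_eq_abs] at this
                  exact this.trans (mul_le_of_le_one_right (norm_nonneg _) (hD1 i)))
                  (abs_nonneg _) zero_le_one
            _ = ‖G x‖ := one_mul _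
        · rw [hg_zero i x fun h => hxO (hUO i h), zero_mul, abs_zero]
          exact indicator_nonneg (fun _ _ => norm_nonneg _) x
      have h3 : ∫ x in (C i)ᶜ, (O i \ C i).indicator (fun x => ‖G x‖) x ∂μ' ≤
          ∫ x, (O i \ C i).indicator (fun x => ‖G x‖) x ∂μ' :=
        setIntegral_le_integral hind (Eventually.of_forall fun x =>
          indicator_nonneg (fun _ _ => norm_nonneg _) x)
      have h4 : ∫ x, (O i \ C i).indicator (fun x => ‖G x‖) x ∂μ' = (ν (O i \ C i)).toReal := by
        rw [integral_indicator ((hOm i).diff (hCm i)), hνreal _ ((hOm i).diff (hCm i))]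
      have h5 : (ν (O i \ C i)).toReal < ε / (N + 1) := by
        rw [measure_sdiff (hCO i) (hCm i).nullMeasurableSet (measure_ne_top _ _),
          ENNReal.toReal_sub_of_le (measure_mono (hCO i)) (measure_ne_top _ _)]
        have h6 := ENNReal.toReal_strict_mono
          (ENNReal.add_ne_top.2 ⟨measure_ne_top _ _, ENNReal.ofReal_ne_top⟩) (hOν i)
        rw [ENNReal.toReal_add (measure_ne_top _ _) ENNReal.ofReal_ne_top,
          ENNReal.toReal_ofReal hεN0.le] at h6
        linarith
      have h7 := neg_abs_le (∫ x in (C i)ᶜ, g i x * G x (D i) ∂μ')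
      linarith
    linarith
  -- summing up
  have hsumC : (ν K).toReal - 2 * ε ≤ ∑ i : Fin N, (ν (C i)).toReal := by
    have hfin : ∀ k, ν (K ∩ B k) ≠ ⊤ := fun k => measure_ne_top _ _
    have h1 : (ν K).toReal ≤ ∑ i : Fin N, (ν (K ∩ B i)).toReal + ε := by
      have hne : ∑ k ∈ Finset.range N, ν (K ∩ B k) ≠ ⊤ :=
        ENNReal.sum_ne_top.2 fun k _ => hfin k
      have h := ENNReal.toReal_mono (ENNReal.add_ne_top.2 ⟨hne, ENNReal.ofReal_ne_top⟩) hN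
      rw [ENNReal.toReal_add hne ENNReal.ofReal_ne_top, ENNReal.toReal_ofReal hε.le,
        ENNReal.toReal_sum (fun k _ => hfin k), Finset.sum_range] at h
      exact h
    have h2 : ∀ i : Fin N, (ν (K ∩ B i)).toReal ≤ (ν (C i)).toReal + ε / (N + 1) := fun i => by
      have h := ENNReal.toReal_mono
        (ENNReal.add_ne_top.2 ⟨measure_ne_top _ _, ENNReal.ofReal_ne_top⟩) (hCν i).le
      rwa [ENNReal.toReal_add (measure_ne_top _ _) ENNReal.ofReal_ne_top,
        ENNReal.toReal_ofReal hεN0.le] at h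
    have h3 : ∑ i : Fin N, (ν (K ∩ B i)).toReal ≤
        ∑ i : Fin N, (ν (C i)).toReal + N * (ε / (N + 1)) := by
      calc ∑ i : Fin N, (ν (K ∩ B i)).toReal ≤ ∑ i : Fin N, ((ν (C i)).toReal + ε / (N + 1)) :=
            Finset.sum_le_sum fun i _ => h2 i
        _ = ∑ i : Fin N, (ν (C i)).toReal + N * (ε / (N + 1)) := by
            rw [Finset.sum_add_distrib, Finset.sum_const, Finset.card_univ, Fintype.card_fin,
              nsmul_eq_mul]
    have h4 : (N : ℝ) * (ε / (N + 1)) ≤ ε := by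
      have : (N : ℝ) / (N + 1) ≤ 1 := (div_le_one (by positivity)).2 (by linarith)
      calc (N : ℝ) * (ε / (N + 1)) = ε * (N / (N + 1)) := by ring
        _ ≤ ε * 1 := by gcongr
        _ = ε := mul_one ε
    linarith
  have hsum_piece : ∑ i : Fin N, ((1 - ε) * (ν (C i)).toReal - ε / (N + 1)) ≤
      ∑ i, ∫ x, g i x * G x (D i) ∂μ' := Finset.sum_le_sum fun i _ => hpiece i
  rw [Finset.sum_sub_distrib, ← Finset.mul_sum, Finset.sum_const, Finset.card_univ,
    Fintype.card_fin, nsmul_eq_mul] at hsum_piece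
  have h4 : (N : ℝ) * (ε / (N + 1)) ≤ ε := by
    have : (N : ℝ) / (N + 1) ≤ 1 := (div_le_one (by positivity)).2 (by linarith)
    calc (N : ℝ) * (ε / (N + 1)) = ε * (N / (N + 1)) := by ring
      _ ≤ ε * 1 := by gcongr
      _ = ε := mul_one ε
  rw [hI, ← hνapp K hKm]
  have h1ε : 0 ≤ 1 - ε := by linarith
  have hprod := mul_le_mul_of_nonneg_left hsumC h1ε
  nlinarith [hprod, hsum_piece, h4, hε, h1ε]

end MassLower

/-! ### Mass of `μ ∧ F` over compacts, and the mass formula for currents of integration -/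

section MassFormula

variable {V : Type*} [NormedAddCommGroup V] [InnerProductSpace ℝ V] [FiniteDimensional ℝ V]
  [MeasurableSpace V] [BorelSpace V] {Ω : Opens V} {m : ℕ}

/-- **`∫_K ‖F‖ dμ ≤ 𝐌(μ ∧ F)` for every compact `K ⊆ Ω`** (`F` locally `μ`-integrable on `Ω`):
the mass of a current representable by integration dominates the variation of its density on
compacts. [cite: Federer1969, 4.1.5 ("‖μ ∧ η‖ = μ ⌞ ‖η‖"), 4.1.7] -/
theorem setLIntegral_enorm_le_mass_vectorCurrent {μ : Measure V} {F : V → Multivector V m}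
    (hF : LocallyIntegrableOn F (Ω : Set V) μ) {K : Set V} (hK : IsCompact K)
    (hKΩ : K ⊆ (Ω : Set V)) :
    ∫⁻ x in K, ‖F x‖ₑ ∂μ ≤ (vectorCurrent μ F : Current Ω m).mass := by
  have hKm : MeasurableSet K := hK.isClosed.measurableSet
  -- a compact neighbourhood `K' = cthickening r K ⊆ Ω` of `K`, `U₀ = thickening r K`
  obtain ⟨r, hr, hrΩ⟩ := hK.exists_cthickening_subset_open Ω.isOpen hKΩ
  have hK' : IsCompact (Metric.cthickening r K) := hK.cthickening
  have hU₀ : IsOpen (Metric.thickening r K) := Metric.isOpen_thickening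
  have hKU₀ : K ⊆ Metric.thickening r K := Metric.self_subset_thickening hr K
  have hU₀K' : Metric.thickening r K ⊆ Metric.cthickening r K :=
    Metric.thickening_subset_cthickening r K
  -- a strongly measurable version `G` of `F` on `K'`
  have hFi : Integrable F (μ.restrict (Metric.cthickening r K)) :=
    hF.integrableOn_compact_subset hrΩ hK'
  have hFa : AEStronglyMeasurable F (μ.restrict (Metric.cthickening r K)) := hFi.aestronglyMeasurable
  have hG : StronglyMeasurable (hFa.mk F) := hFa.stronglyMeasurable_mk
  have hFG : F =ᵐ[μ.restrict (Metric.cthickening r K)] hFa.mk F := hFa.ae_eq_mk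
  have hGi : Integrable (hFa.mk F) (μ.restrict (Metric.cthickening r K)) := hFi.congr hFG
  have hrestr : (μ.restrict (Metric.cthickening r K)).restrict K = μ.restrict K := by
    rw [Measure.restrict_restrict hKm, inter_eq_left.2 (hKU₀.trans hU₀K')]
  have hX : ∫⁻ x in K, ‖F x‖ₑ ∂μ = ∫⁻ x in K, ‖hFa.mk F x‖ₑ ∂(μ.restrict (Metric.cthickening r K)) := by
    rw [hrestr]
    refine lintegral_congr_ae ?_
    have : F =ᵐ[μ.restrict K] hFa.mk F := by rw [← hrestr]; exact ae_restrict_of_ae hFG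
    exact this.mono fun x hx => by simp only [hx]
  have hXtop : ∫⁻ x in K, ‖hFa.mk F x‖ₑ ∂(μ.restrict (Metric.cthickening r K)) ≠ ⊤ :=
    ((lintegral_mono' Measure.restrict_le_self le_rfl).trans_lt hGi.2).ne
  by_cases hmass : (vectorCurrent μ F : Current Ω m).mass = ⊤
  · rw [hmass]; exact le_top
  -- the estimate for every `ε`, then `ε → 0`
  have key : ∀ ε : ℝ, 0 < ε → ε < 1 →
      (1 - ε) * (∫⁻ x in K, ‖hFa.mk F x‖ₑ ∂(μ.restrict (Metric.cthickening r K))).toReal - 3 * ε ≤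
        ((vectorCurrent μ F : Current Ω m).mass).toReal := by
    intro ε hε hε1
    obtain ⟨φ, hφ1, hφ0, hφge⟩ := exists_testForm_integral_ge (Ω := Ω)
      (μ.restrict (Metric.cthickening r K)) hG hGi hK hK' hU₀ hKU₀ hU₀K' hrΩ hε hε1
    have hT : vectorCurrent μ F φ = ∫ x, hFa.mk F x (φ x) ∂(μ.restrict (Metric.cthickening r K)) := by
      rw [vectorCurrent_apply hF, ← setIntegral_eq_integral_of_forall_compl_eq_zero
        (s := Metric.cthickening r K) (fun x hx => by rw [hφ0 x fun h => hx (hU₀K' h), map_zero])]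
      exact integral_congr_ae (hFG.mono fun x hx => by simp only [hx])
    have hle : ENNReal.ofReal (vectorCurrent μ F φ) ≤ (vectorCurrent μ F : Current Ω m).mass :=
      Current.ofReal_apply_le_mass _ hφ1
    have h1 : vectorCurrent μ F φ ≤ (ENNReal.ofReal (vectorCurrent μ F φ)).toReal := by
      rw [ENNReal.toReal_ofReal']
      exact le_max_left _ _
    have h2 := ENNReal.toReal_mono hmass hle
    linarith
  have hlim : (∫⁻ x in K, ‖hFa.mk F x‖ₑ ∂(μ.restrict (Metric.cthickening r K))).toReal ≤
      ((vectorCurrent μ F : Current Ω m).mass).toReal := by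
    set X := (∫⁻ x in K, ‖hFa.mk F x‖ₑ ∂(μ.restrict (Metric.cthickening r K))).toReal
    have htend : Tendsto (fun ε : ℝ => (1 - ε) * X - 3 * ε) (𝓝[>] 0)
        (𝓝 ((1 - 0) * X - 3 * 0)) :=
      ((((continuous_const.sub continuous_id).mul continuous_const).sub
        (continuous_const.mul continuous_id)).tendsto 0).mono_left nhdsWithin_le_nhds
    rw [sub_zero, one_mul, mul_zero, sub_zero] at htend
    refine le_of_tendsto htend ?_
    filter_upwards [Ioo_mem_nhdsGT one_pos] with ε hε
    exact key ε hε.1 hε.2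
  rw [hX]
  exact (ENNReal.toReal_le_toReal hXtop hmass).1 hlim

/-- **Mass of a current of integration over compacts**: for admissible data,
`∫_{W ∩ K} |θ| d𝓗^m ≤ 𝐌([W, θ, ξ])` for every compact `K ⊆ Ω` (`‖θ ξ₁ ∧ ⋯ ∧ ξₘ‖ = |θ|` a.e.).
[cite: Federer1969, 4.1.28 (5)] -/
theorem IsRectifiableData.setLIntegral_le_mass {W : Set V} {θ : V → ℤ} {ξ : V → Fin m → V}
    (h : IsRectifiableData Ω m W θ ξ) {K : Set V} (hK : IsCompact K) (hKΩ : K ⊆ (Ω : Set V)) :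
    ∫⁻ x in W ∩ K, ‖(θ x : ℝ)‖ₑ ∂(μHE[m] : Measure V) ≤
      (currentOfIntegration W θ ξ : Current Ω m).mass := by
  have hKm : MeasurableSet K := hK.isClosed.measurableSet
  have h1 := setLIntegral_enorm_le_mass_vectorCurrent (m := m) h.2.2.2.1 hK hKΩ
  refine le_trans (le_of_eq ?_) h1
  rw [Measure.restrict_restrict hKm, inter_comm]
  refine lintegral_congr_ae ?_
  have hae : ∀ᵐ x ∂(μHE[m] : Measure V).restrict (K ∩ W), Orthonormal ℝ (ξ x) := by
    filter_upwards [ae_mono (Measure.restrict_mono inter_subset_right le_rfl) h.2.2.2.2] with x hx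
    exact hx.1
  filter_upwards [hae] with x hx
  rw [enorm_smul, ← ofReal_norm (frameVector (ξ x)), norm_frameVector_eq_one hx,
    ENNReal.ofReal_one, mul_one]

/-- **The mass formula for currents of integration**: for admissible data,
`𝐌([W, θ, ξ]) = ∫_W |θ| d𝓗^m` ("‖T‖ = 𝓗^m ⌞ |θ|" for `T = (𝓗^m ⌞ W) ∧ θ ξ`, as far as total mass
is concerned). [cite: Federer1969, 4.1.28 (5)] -/
theorem IsRectifiableData.mass_eq {W : Set V} {θ : V → ℤ} {ξ : V → Fin m → V}
    (h : IsRectifiableData Ω m W θ ξ) :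
    (currentOfIntegration W θ ξ : Current Ω m).mass = ∫⁻ x in W, ‖(θ x : ℝ)‖ₑ ∂(μHE[m] : Measure V) := by
  refine le_antisymm h.mass_le ?_
  obtain ⟨K, hKc, hKΩ, hKabs⟩ := exists_compact_exhaustion Ω
  have hcov : W ⊆ ⋃ n, Set.accumulate K n := by
    rw [Set.iUnion_accumulate]
    intro x hx
    obtain ⟨n, hn⟩ := hKabs {x} isCompact_singleton (singleton_subset_iff.2 (h.2.1 hx))
    exact mem_iUnion.2 ⟨n, hn rfl⟩
  have hmono : Monotone fun n => W ∩ Set.accumulate K n :=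
    fun a b hab => inter_subset_inter_right _ (Set.monotone_accumulate hab)
  calc ∫⁻ x in W, ‖(θ x : ℝ)‖ₑ ∂(μHE[m] : Measure V)
      = ∫⁻ x in ⋃ n, W ∩ Set.accumulate K n, ‖(θ x : ℝ)‖ₑ ∂(μHE[m] : Measure V) := by
        rw [← inter_iUnion, inter_eq_left.2 hcov]
    _ = ⨆ n, ∫⁻ x in W ∩ Set.accumulate K n, ‖(θ x : ℝ)‖ₑ ∂(μHE[m] : Measure V) :=
        setLIntegral_iUnion_of_directed _ hmono.directed_le
    _ ≤ (currentOfIntegration W θ ξ : Current Ω m).mass := iSup_le fun n =>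
        h.setLIntegral_le_mass (isCompact_accumulate hKc n)
          (iUnion₂_subset fun i _ => hKΩ i)

/-- A current of integration with admissible data has finite mass iff its multiplicity is
`𝓗^m ⌞ W`-summable. [cite: Federer1969, 4.1.28 (5)] -/
theorem IsRectifiableData.mass_lt_top_iff {W : Set V} {θ : V → ℤ} {ξ : V → Fin m → V}
    (h : IsRectifiableData Ω m W θ ξ) :
    (currentOfIntegration W θ ξ : Current Ω m).mass < ⊤ ↔
      ∫⁻ x in W, ‖(θ x : ℝ)‖ₑ ∂(μHE[m] : Measure V) < ⊤ := by
  rw [h.mass_eq]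

/-- **Rectifiable currents have finite mass**: for admissible data with compact support
`spt [W, θ, ξ] ⊆ Ω`, the density vanishes `𝓗^m ⌞ W`-a.e. off the support (Federer 4.1.7, here
`ae_eq_zero_of_mem_sdiff_support_vectorCurrent`), so `𝐌([W, θ, ξ]) = ∫_{W ∩ spt} |θ| d𝓗^m < ∞`
by local integrability. [cite: Federer1969, 4.1.28 ((4) ⇒ (5): 𝐌(T) < ∞)] -/
theorem IsRectifiableData.mass_lt_top_of_isCompact_support {W : Set V} {θ : V → ℤ}
    {ξ : V → Fin m → V} (h : IsRectifiableData Ω m W θ ξ)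
    (hc : IsCompact (currentOfIntegration W θ ξ : Current Ω m).support) :
    (currentOfIntegration W θ ξ : Current Ω m).mass < ⊤ := by
  set T : Current Ω m := currentOfIntegration W θ ξ with hT
  have hsptΩ : T.support ⊆ (Ω : Set V) := T.support_subset
  -- `𝐌(T) = ∫ ‖F‖ dμ`, `μ = 𝓗^m ⌞ W`, `F = θ ξ`
  have hmass : T.mass = ∫⁻ x, ‖(θ x : ℝ) • frameVector (ξ x)‖ₑ ∂((μHE[m] : Measure V).restrict W) := by
    rw [hT, h.mass_eq]
    refine lintegral_congr_ae ?_
    filter_upwards [h.2.2.2.2] with x hx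
    rw [enorm_smul, ← ofReal_norm (frameVector (ξ x)), norm_frameVector_eq_one hx.1,
      ENNReal.ofReal_one, mul_one]
  -- off the support the density vanishes a.e.; `W ⊆ Ω`
  have hzero := ae_eq_zero_of_mem_sdiff_support_vectorCurrent (m := m) (Ω := Ω) h.2.2.2.1
  have hW : ∀ᵐ x ∂((μHE[m] : Measure V).restrict W), x ∈ W := ae_restrict_mem h.1
  have hint : IntegrableOn (fun x => (θ x : ℝ) • frameVector (ξ x)) T.support
      ((μHE[m] : Measure V).restrict W) :=
    h.2.2.2.1.integrableOn_compact_subset hsptΩ hc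
  have hsm : MeasurableSet T.support := hc.isClosed.measurableSet
  rw [hmass, ← lintegral_add_compl _ hsm]
  have h0 : ∫⁻ x in T.supportᶜ, ‖(θ x : ℝ) • frameVector (ξ x)‖ₑ
      ∂((μHE[m] : Measure V).restrict W) = 0 := by
    refine (lintegral_congr_ae ?_).trans lintegral_zero
    filter_upwards [ae_restrict_mem hsm.compl, ae_restrict_of_ae hW, ae_restrict_of_ae hzero]
      with x hxS hxW hx0
    rw [hx0 ⟨h.2.1 hxW, hxS⟩, enorm_zero]
  rw [h0, add_zero]
  exact hint.2

end MassFormula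

end Literature.Geometry.GeometricMeasureTheory
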